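/-
Copyright (c) 2026 the pub-hodgecm-mathlib formalisation cell (harness21).  Prover seat hodgecm-mathlib-A-p12 (g24), 2026-09-02.  «S3-ram» seeding wave (LEAD F0P3a-plan (g12)
T11-80; owner F0P3a-p06 (g15); fold pen F0P3-p02 (g17)): the (α₂) TYPE-(2) ROW (T2) with its two G-side inputs RE-KEYED on a neighbourhood of `1` (skeleton v0.6; kernel lane).
-/
import Literature.NumberTheory.Rogawski1990.DepthZeroKappaTransferTypeTwoRamifiedRow   -- ★ p847306 (this lineage, g23) FILE D: ED. 1 of the row (γH-keyed G-inputs); brings FILE C, the span lemmas, the tube, the frame tokens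
import HarnessLib

/-!
# The TYPE-(2) ROW of the tame-ramified depth-zero κ-transfer, EDITION 2: the two type-(2) G-side rows are consumed ON A NEIGHBOURHOOD OF `1` (∃V-shaped, as the
# type-(1) explicit G-row A′e), the head intersects them with the 2-deep tube (Rogawski 1990 §4.9 Prop. 4.9.1; Labesse–Langlands 1979 §2; Langlands–Shelstad 1990 §2.1)

Topic `NumberTheory/Rogawski1990`; namespace `Literature.NumberTheory.Rogawski1990`.  THEOREMS ONLY (no definition, no instance, no notation, no named fact, no `sorry`); kernel lane
`--supports stmt-HodgeConjecture-24833`.  Cell `pub/hodgecm-mathlib` (D-0151), crux H413; «S3-ram» seeding wave; seat A-p12 (g24), architect (heir) of the (α₂) line.  HONEST LABEL: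
HC_CM is proved only modulo the cell's 2 remaining named inputs (hLiu418 24832, h413 24833) until rung 0 closes; this file is an ASSEMBLY over ★ material with three explicit
hypotheses and asserts nothing printed.

WHY AN EDITION 2.  ED. 1 (★ `typeTwoRow_ram_of_typeTwoGSide_of_massRatio`, = HOME skeleton (α₂) v0.5) consumed the two type-(2) G-side rows `hGe`∕`hGo` γ_H-KEYED on the 1-deep
tube of the `2 × 2` block ONLY (`|(γ_{2,w} − 1)_{ij}| ≤ |ϖ_w|`, nothing on `γ_H.2 = u₁`).  In that generality the G-rows are FALSE: for `u₁ = −1` (or for `|λ − 1|_w = |ϖ_w|`)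
every monodromy `h⁻¹γ′h ∈ K` of a class `γ′` in the stable class of `ι(γ_H)` has a residual eigenvalue `≠ 1` (resp. a non-nilpotent first-layer residual), so it lies in NONE
of the five two-layer strata `bd ∕ reg ∕ 1□ ∕ 1¬□ ∕ 0` whose values `c₂, c′2, c₁s, c₁n, c′0` the right-hand side is built from — a piece `g` supported on such monodromies has all
`c_j = 0` and a non-zero left-hand side.  The sockets A-p16 (g31) typed for the type-(1) population (A′e, fold v7.2 :155) avoid this by concluding `∃ V ∈ 𝓝 1, ∀ γ_H ∈ V, …`;
EDITION 2 gives the type-(2) G-rows EXACTLY that shape (skeleton v0.6 :78 ∕ :151, `F0/P3a/A-p12/g24/…skeleton.v6.A-p12g24.lean` 8f799825), so that their prover (F0P3a-p07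
(g13), organ (d)) chooses `V` — the 2-deep tube in both coordinates, ★ `setOf_entrywise_deep_mem_nhds_one … (c := ϖ²)`, is the natural choice: there every monodromy falls in
exactly one stratum.  The fold's socket (T2) :594 is UNCHANGED (its conclusion is already `∃ V ∈ 𝓝 1, …`) and closes by
`exact typeTwoRow_ram_of_typeTwoGSideNhds_of_massRatio <:594 binders> hGe hGo hM2` once the re-keyed sockets :293∕:366 and (M2) :438 are theorems.

THE ASSEMBLY (`typeTwoRow_ram_of_typeTwoGSideNhds_of_massRatio`).  `V := V_e ∩ V_o ∩ {γ_H | γ_{2,w} ≡ 1, u_{1,w} ≡ 1 (mod ϖ_w²)}`; for `γ_H ∈ V` `G`-regular of type (2):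
2-deep ⇒ 1-deep (for ★ FILE C), `|tr|, |det| ≤ 1` (★ `valuation_quadratic_bounds_of_entrywise_deep`), `disc ≠ 0` (no root, `|2| = 1`), so `|tr² − 4det|_w = exp(−2N)` (★
F0P2-p02 `exists_valued_disc_eq_exp_neg_even_of_ne_zero_ramified`) with `2 ≤ N` (§0: `|tr² − 4det| ≤ |ϖ²|²` on the 2-deep tube) — hence the rider `1 ≤ n` in BOTH parities;
split `N = 2n ∕ 2n+1`; rewrite the G-row (`hGe`∕`hGo` at `γ_H ∈ V_e ∕ V_o`), the two H-values (★ FILE C `stableOrbitalIntegralRel_typeTwo_HSide_of_{even,odd}_depth_ramified` at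
`C′ := K₂ 1` of ★ `exists_vertexCover_of_ramified`), the mass (`hM2`), and close with ★ B-p14 `span_typeTwo{Unr,Ram}_of_strata_values` + `field_simp` — byte-identical to ED. 1
from the depth token on.

* §0 `valued_disc_le_sq_of_entrywise_le` — `|tr² g − 4 det g| ≤ |c|²` when `g ≡ 1 (mod c)` entrywise (any radius; `c = ϖ²` gives `2 ≤ N`).
* §1 **`typeTwoRow_ram_of_typeTwoGSideNhds_of_massRatio`** — (T2) :594 VERBATIM from `hGe`, `hGo` (∃V-shaped, v0.6 texts) and `hM2` (unchanged text).

## References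
* [Rogawski1990] J. D. Rogawski, *Automorphic Representations of Unitary Groups in Three Variables*, Ann. of Math. Stud. 123 (1990): §4.9 Prop. 4.9.1 (a)(b) p. 55; §8.1 Prop. 8.1.1
  p. 112; §3.6 p. 31.
* [LabesseLanglands1979] J.-P. Labesse, R. P. Langlands, *L-indistinguishability for SL(2)*, Canad. J. Math. 31 (1979): §2 Lemma 2.1 p. 8.
* [LanglandsShelstad1990Descent] R. Langlands, D. Shelstad, *Descent for transfer factors* (1990): §2.1 (2.1.2).
-/

set_option autoImplicit false

noncomputable section

open MeasureTheory Measure Set Function NumberField IsDedekindDomain Matrix Polynomial Topology Filter Finset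
open Literature.NumberTheory.Automorphic Literature.NumberTheory.Automorphic.UnitaryGroup
open Literature.NumberTheory.Automorphic.IntegralReduction Literature.NumberTheory.GaloisRepresentations
open Literature.NumberTheory.QuadraticForms
open Literature.AlgebraicGeometry.ShimuraVarieties (unitaryGroup)
open Literature.MeasureTheory.Group (descConj)
open scoped Matrix MatrixGroups ValuativeRel Classical

namespace Literature.NumberTheory.Rogawski1990

/-! ## §0 The discriminant of an entrywise-deep `2 × 2` block -/

/-- **`|tr² g − 4 det g| ≤ |c|²` when `g ≡ 1 (mod c)` entrywise**: `tr² − 4det = ((g₀₀−1) − (g₁₁−1))² + 4·g₀₁·g₁₀` and `|4| ≤ 1`.  On the 2-deep tube (`c = ϖ_w²`) a depth token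
`|tr² − 4det|_w = exp(−2N)` therefore has `2 ≤ N` — the rider `1 ≤ n` of the G-rows in both parities `N = 2n`, `N = 2n+1`. [cite: Rogawski1990, §3.6 p. 31; §4.9 p. 55] -/
theorem valued_disc_le_sq_of_entrywise_le {L : Type} [Field L] [NumberField L] {v : HeightOneSpectrum (𝓞 ↥(maximalRealSubfield L))} {w : PlacesOver L v}
    (g : Matrix (Fin 2) (Fin 2) (w.1.adicCompletion L)) {c : w.1.adicCompletion L}
    (hg : ∀ i j : Fin 2, Valued.v ((g - 1) i j) ≤ Valued.v c) :
    Valued.v (g.trace ^ 2 - 4 * g.det) ≤ Valued.v c ^ 2 := by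
  have h00 : Valued.v (g 0 0 - 1) ≤ Valued.v c := by have h := hg 0 0; rwa [Matrix.sub_apply, Matrix.one_apply_eq] at h
  have h11 : Valued.v (g 1 1 - 1) ≤ Valued.v c := by have h := hg 1 1; rwa [Matrix.sub_apply, Matrix.one_apply_eq] at h
  have h01 : Valued.v (g 0 1) ≤ Valued.v c := by
    have h := hg 0 1; rwa [Matrix.sub_apply, Matrix.one_apply_ne (by decide), sub_zero] at h
  have h10 : Valued.v (g 1 0) ≤ Valued.v c := by
    have h := hg 1 0; rwa [Matrix.sub_apply, Matrix.one_apply_ne (by decide), sub_zero] at h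
  have h4 : Valued.v (4 : w.1.adicCompletion L) ≤ 1 := by
    have h := v_natCast_le_one (K := w.1.adicCompletion L) 4
    rwa [Nat.cast_ofNat] at h
  have e : g.trace ^ 2 - 4 * g.det = ((g 0 0 - 1) - (g 1 1 - 1)) * ((g 0 0 - 1) - (g 1 1 - 1)) + 4 * (g 0 1 * g 1 0) := by
    rw [Matrix.trace_fin_two, Matrix.det_fin_two]; ring
  rw [e, sq]
  refine (Valuation.map_add _ _ _).trans (max_le ?_ ?_)
  · rw [Valuation.map_mul]
    exact mul_le_mul' ((Valuation.map_sub _ _ _).trans (max_le h00 h11)) ((Valuation.map_sub _ _ _).trans (max_le h00 h11))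
  · rw [Valuation.map_mul, Valuation.map_mul]
    calc Valued.v (4 : w.1.adicCompletion L) * (Valued.v (g 0 1) * Valued.v (g 1 0)) ≤ 1 * (Valued.v c * Valued.v c) := mul_le_mul' h4 (mul_le_mul' h01 h10)
      _ = Valued.v c * Valued.v c := one_mul _

/-! ## §1 (T2) :594 from the ∃V-shaped G-rows and the mass ratio -/

set_option maxHeartbeats 3200000 in
/-- **THE TYPE-(2) ROW (T2) OF FOLD v7.2 :594 FROM ITS THREE INPUTS, EDITION 2** — binders = the socket's VERBATIM, then `hGe`∕`hGo` = the type-(2) G-side rows at even∕odd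
discriminant depth ON A NEIGHBOURHOOD OF `1` (`∃ V ∈ 𝓝 1, ∀ γ_H ∈ V, G-regular → no root at w → ∀ n, |tr² − 4det|_w = exp(−2·(2n)) resp. exp(−2·(2n+1)) → 1 ≤ n → Σᶠ Δ·Φ =
(y_λ,θ)_v·ν_G(K′)·Σ_j c_j X̃_j(n)`, skeleton v0.6 :78∕:151 texts — the A′e shape) and `hM2` (`2·ν_H(χ♯-set) = (q+1)·ν_H(K_H)`); conclusion = the socket's VERBATIM (`∃ V ∈ 𝓝 1`, …).
Proof: `V := V_e ∩ V_o ∩ (2-deep tube)`, then as in ED. 1 (module docstring). [cite: Rogawski1990, §4.9 Prop. 4.9.1 (a)(b) p. 55; §8.1 Prop. 8.1.1 p. 112]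
[cite: LabesseLanglands1979, §2 Lemma 2.1 p. 8] [cite: LanglandsShelstad1990Descent, §2.1 (2.1.2)] -/
theorem typeTwoRow_ram_of_typeTwoGSideNhds_of_massRatio
    (L : Type) [Field L] [NumberField L] [IsCMField L] (H' : Matrix (Fin 3) (Fin 3) L) (μ : HeckeCharacter L)
    {v : HeightOneSpectrum (𝓞 ↥(maximalRealSubfield L))}
    (_hH' : (H'.map (cmConjRingHom L)).transpose = H') (w : PlacesOver L v)
    (hw : IsCMField.complexConj L • w.1 = w.1) (he : v.asIdeal.ramificationIdx' w.1.asIdeal ≠ 1)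
    (hH'w : IsUnit (placeForm H' w.1)) (_hH'i : hH'w.unit ∈ glInt 3 (w.1.adicCompletion L))
    (_hμu : μ.IsUnitary)
    (_hμω : ∀ x : ideleGroup ↥(maximalRealSubfield L), μ (AdeleRing.ideleBaseChange ↥(maximalRealSubfield L) L x) = quadraticHeckeCharCM L x)
    (h2 : IsUnit (2 : 𝒪[w.1.adicCompletion L]))
    -- the ramified block (R) and the integral antidiagonal frame of `H′_w` (★ `ramifiedBlock_adicCompletion`, ★ p846344) — SUPPLIED by the contract, BINDERS for the sockets
    (ϖ : w.1.adicCompletion L) (hϖ : Valued.v ϖ = WithZero.exp (-1 : ℤ)) (hσϖ : galAdicCompletionMap (L := L) (IsCMField.complexConj L) hw ϖ = -ϖ)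
    (A : GL (Fin 3) (w.1.adicCompletion L)) (_hA : A ∈ glInt 3 (w.1.adicCompletion L))
    (_hframe : placeForm H' w.1 = (-(placeForm H' w.1).det) • formCongr (galAdicCompletionMap (L := L) (IsCMField.complexConj L) hw) A ((StdForm.antidiagonal 3).over (w.1.adicCompletion L)))
    [MeasurableSpace ((cmDatum L 3 H').Local v)] [BorelSpace ((cmDatum L 3 H').Local v)]
    [∀ γ : ((cmDatum L 3 H').Local v), MeasurableSpace (((cmDatum L 3 H').Local v) ⧸ Subgroup.centralizer ({γ} : Set ((cmDatum L 3 H').Local v)))]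
    [∀ γ : ((cmDatum L 3 H').Local v), BorelSpace (((cmDatum L 3 H').Local v) ⧸ Subgroup.centralizer ({γ} : Set ((cmDatum L 3 H').Local v)))]
    [MeasurableSpace ((cmDatum L 2 (Matrix.of fun i j : Fin 2 => if i.val + j.val + 1 = 2 then (1 : L) else 0)).Local v × (cmDatum L 1 (Matrix.of fun i j : Fin 1 => if i.val + j.val + 1 = 1 then (1 : L) else 0)).Local v)] [BorelSpace ((cmDatum L 2 (Matrix.of fun i j : Fin 2 => if i.val + j.val + 1 = 2 then (1 : L) else 0)).Local v × (cmDatum L 1 (Matrix.of fun i j : Fin 1 => if i.val + j.val + 1 = 1 then (1 : L) else 0)).Local v)]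
  [∀ a : (cmDatum L 2 (Matrix.of fun i j : Fin 2 => if i.val + j.val + 1 = 2 then (1 : L) else 0)).Local v × (cmDatum L 1 (Matrix.of fun i j : Fin 1 => if i.val + j.val + 1 = 1 then (1 : L) else 0)).Local v, MeasurableSpace (((cmDatum L 2 (Matrix.of fun i j : Fin 2 => if i.val + j.val + 1 = 2 then (1 : L) else 0)).Local v × (cmDatum L 1 (Matrix.of fun i j : Fin 1 => if i.val + j.val + 1 = 1 then (1 : L) else 0)).Local v) ⧸ Subgroup.centralizer ({a} : Set ((cmDatum L 2 (Matrix.of fun i j : Fin 2 => if i.val + j.val + 1 = 2 then (1 : L) else 0)).Local v × (cmDatum L 1 (Matrix.of fun i j : Fin 1 => if i.val + j.val + 1 = 1 then (1 : L) else 0)).Local v)))]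
  [∀ a : (cmDatum L 2 (Matrix.of fun i j : Fin 2 => if i.val + j.val + 1 = 2 then (1 : L) else 0)).Local v × (cmDatum L 1 (Matrix.of fun i j : Fin 1 => if i.val + j.val + 1 = 1 then (1 : L) else 0)).Local v, BorelSpace (((cmDatum L 2 (Matrix.of fun i j : Fin 2 => if i.val + j.val + 1 = 2 then (1 : L) else 0)).Local v × (cmDatum L 1 (Matrix.of fun i j : Fin 1 => if i.val + j.val + 1 = 1 then (1 : L) else 0)).Local v) ⧸ Subgroup.centralizer ({a} : Set ((cmDatum L 2 (Matrix.of fun i j : Fin 2 => if i.val + j.val + 1 = 2 then (1 : L) else 0)).Local v × (cmDatum L 1 (Matrix.of fun i j : Fin 1 => if i.val + j.val + 1 = 1 then (1 : L) else 0)).Local v)))]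
    (νH : Measure ((cmDatum L 2 (Matrix.of fun i j : Fin 2 => if i.val + j.val + 1 = 2 then (1 : L) else 0)).Local v × (cmDatum L 1 (Matrix.of fun i j : Fin 1 => if i.val + j.val + 1 = 1 then (1 : L) else 0)).Local v)) [νH.IsHaarMeasure] [νH.IsMulRightInvariant]
    (νG : Measure ((cmDatum L 3 H').Local v)) [νG.IsHaarMeasure] [νG.IsMulRightInvariant]
    {mH : OrbitalMeasureFamily ((cmDatum L 2 (Matrix.of fun i j : Fin 2 => if i.val + j.val + 1 = 2 then (1 : L) else 0)).Local v × (cmDatum L 1 (Matrix.of fun i j : Fin 1 => if i.val + j.val + 1 = 1 then (1 : L) else 0)).Local v)} {mG : OrbitalMeasureFamily ((cmDatum L 3 H').Local v)}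
    (hmH : mH.IsCanonical (IsLocalGRegular L v) νH)
    (_hmG : mG.IsCanonical (fun γ => IsRegularElt (γ.val : GL (Fin 3) (UnitaryGroup.LocalRing L v))) νG)
    -- the piece: `C_c^∞`, supported in the hyperspecial `K`, `Ad K`-invariant, left-invariant under the level-2 congruence set (A-69 (β), `j = 2`)
    (g : ((cmDatum L 3 H').Local v) → ℂ) (_hg : IsLocSmooth g) (_hgK : tsupport g ⊆ (cmLocalIntegralLevel L 3 H' v : Set ((cmDatum L 3 H').Local v)))
    (_hginv : ∀ u ∈ cmLocalIntegralLevel L 3 H' v, ∀ x, g (u * x * u⁻¹) = g x)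
    (_hg1 : ∀ u : (cmDatum L 3 H').Local v,
      (∀ a b, Valued.v (((toPlace v w (HeckeCharacter.uniformizer ↥(maximalRealSubfield L) v : v.adicCompletion ↥(maximalRealSubfield L))) ^ 1)⁻¹ *
        ((((localNonsplitEquiv (IsCMField.complexConj L) H' (IsCMField.complexConj_ne_one L) w hw u :
            ↥(unitaryGroupOfForm (galAdicCompletionMap (L := L) (IsCMField.complexConj L) hw) (placeForm H' w.1))) : GL (Fin 3) (w.1.adicCompletion L)) :
              Matrix (Fin 3) (Fin 3) (w.1.adicCompletion L)) a b - (1 : Matrix (Fin 3) (Fin 3) (w.1.adicCompletion L)) a b)) ≤ 1) →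
      ∀ x, g (u * x) = g x)
    -- the two-layer strata values of `g` (★ F0P2-p01 head rows VERBATIM, in the (L)-ram L5-C2 binder shapes)
    (c₂ : ℂ) (c' : ℕ → ℂ) (_hc : ∀ x : ((cmDatum L 3 H').Local v), (x ∈ cmLocalIntegralLevel L 3 H' v ∧ (redMat (((x).val : GL (Fin 3) (UnitaryGroup.LocalRing L v)).val.map (Pi.evalRingHom (fun w' : PlacesOver L v => w'.1.adicCompletion L) w)) - 1) ^ 3 = 0 ∧ (redMat (((x).val : GL (Fin 3) (UnitaryGroup.LocalRing L v)).val.map (Pi.evalRingHom (fun w' : PlacesOver L v => w'.1.adicCompletion L) w)) - 1).rank = 2 ∧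
        ∃ y : ((cmDatum L 3 H').Local v), (∀ a b, Valued.v (((toPlace v w (HeckeCharacter.uniformizer ↥(maximalRealSubfield L) v : v.adicCompletion ↥(maximalRealSubfield L))) ^ 1)⁻¹ *
        ((((localNonsplitEquiv (IsCMField.complexConj L) H' (IsCMField.complexConj_ne_one L) w hw (y * x * y⁻¹) :
            ↥(unitaryGroupOfForm (galAdicCompletionMap (L := L) (IsCMField.complexConj L) hw) (placeForm H' w.1))) : GL (Fin 3) (w.1.adicCompletion L)) :
              Matrix (Fin 3) (Fin 3) (w.1.adicCompletion L)) a b - (1 : Matrix (Fin 3) (Fin 3) (w.1.adicCompletion L)) a b)) ≤ 1)) → g x = c₂)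
    (hc' : ((∀ x : ((cmDatum L 3 H').Local v), (x ∈ cmLocalIntegralLevel L 3 H' v ∧ (∀ a b, Valued.v (ϖ⁻¹ * ((((x).val : GL (Fin 3) (UnitaryGroup.LocalRing L v)).val.map (Pi.evalRingHom (fun w' : PlacesOver L v => w'.1.adicCompletion L) w)) a b - (1 : Matrix (Fin 3) (Fin 3) (w.1.adicCompletion L)) a b)) ≤ 1) ∧
        (redMat (ϖ⁻¹ • ((((x).val : GL (Fin 3) (UnitaryGroup.LocalRing L v)).val.map (Pi.evalRingHom (fun w' : PlacesOver L v => w'.1.adicCompletion L) w)) - 1))) ^ 3 = 0 ∧ (redMat (ϖ⁻¹ • ((((x).val : GL (Fin 3) (UnitaryGroup.LocalRing L v)).val.map (Pi.evalRingHom (fun w' : PlacesOver L v => w'.1.adicCompletion L) w)) - 1))).rank = 0) → g x = c' 0) ∧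
      (∀ x : ((cmDatum L 3 H').Local v), (x ∈ cmLocalIntegralLevel L 3 H' v ∧ (∀ a b, Valued.v (ϖ⁻¹ * ((((x).val : GL (Fin 3) (UnitaryGroup.LocalRing L v)).val.map (Pi.evalRingHom (fun w' : PlacesOver L v => w'.1.adicCompletion L) w)) a b - (1 : Matrix (Fin 3) (Fin 3) (w.1.adicCompletion L)) a b)) ≤ 1) ∧
        (redMat (ϖ⁻¹ • ((((x).val : GL (Fin 3) (UnitaryGroup.LocalRing L v)).val.map (Pi.evalRingHom (fun w' : PlacesOver L v => w'.1.adicCompletion L) w)) - 1))) ^ 3 = 0 ∧ (redMat (ϖ⁻¹ • ((((x).val : GL (Fin 3) (UnitaryGroup.LocalRing L v)).val.map (Pi.evalRingHom (fun w' : PlacesOver L v => w'.1.adicCompletion L) w)) - 1))).rank = 2) → g x = c' 2)))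
    (c₁s c₁n : ℂ)
    (hR4s : (∀ (x : ((cmDatum L 3 H').Local v)) (z : Fin 3 → 𝓀[(w.1.adicCompletion L)]), (x ∈ cmLocalIntegralLevel L 3 H' v ∧
        (∀ a b, Valued.v (ϖ⁻¹ * ((((x).val : GL (Fin 3) (UnitaryGroup.LocalRing L v)).val.map (Pi.evalRingHom (fun w' : PlacesOver L v => w'.1.adicCompletion L) w)) a b - (1 : Matrix (Fin 3) (Fin 3) (w.1.adicCompletion L)) a b)) ≤ 1) ∧
        (redMat (ϖ⁻¹ • ((((x).val : GL (Fin 3) (UnitaryGroup.LocalRing L v)).val.map (Pi.evalRingHom (fun w' : PlacesOver L v => w'.1.adicCompletion L) w)) - 1))) ^ 3 = 0 ∧ (redMat (ϖ⁻¹ • ((((x).val : GL (Fin 3) (UnitaryGroup.LocalRing L v)).val.map (Pi.evalRingHom (fun w' : PlacesOver L v => w'.1.adicCompletion L) w)) - 1))).rank = 1 ∧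
        z ⬝ᵥ ((redMat (placeForm H' w.1) * redMat (ϖ⁻¹ • ((((x).val : GL (Fin 3) (UnitaryGroup.LocalRing L v)).val.map (Pi.evalRingHom (fun w' : PlacesOver L v => w'.1.adicCompletion L) w)) - 1))) *ᵥ z) ≠ 0 ∧ IsSquare (z ⬝ᵥ ((redMat (placeForm H' w.1) * redMat (ϖ⁻¹ • ((((x).val : GL (Fin 3) (UnitaryGroup.LocalRing L v)).val.map (Pi.evalRingHom (fun w' : PlacesOver L v => w'.1.adicCompletion L) w)) - 1))) *ᵥ z))) →
        g x = c₁s))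
    (hR4n : (∀ (x : ((cmDatum L 3 H').Local v)) (z : Fin 3 → 𝓀[(w.1.adicCompletion L)]), (x ∈ cmLocalIntegralLevel L 3 H' v ∧
        (∀ a b, Valued.v (ϖ⁻¹ * ((((x).val : GL (Fin 3) (UnitaryGroup.LocalRing L v)).val.map (Pi.evalRingHom (fun w' : PlacesOver L v => w'.1.adicCompletion L) w)) a b - (1 : Matrix (Fin 3) (Fin 3) (w.1.adicCompletion L)) a b)) ≤ 1) ∧
        (redMat (ϖ⁻¹ • ((((x).val : GL (Fin 3) (UnitaryGroup.LocalRing L v)).val.map (Pi.evalRingHom (fun w' : PlacesOver L v => w'.1.adicCompletion L) w)) - 1))) ^ 3 = 0 ∧ (redMat (ϖ⁻¹ • ((((x).val : GL (Fin 3) (UnitaryGroup.LocalRing L v)).val.map (Pi.evalRingHom (fun w' : PlacesOver L v => w'.1.adicCompletion L) w)) - 1))).rank = 1 ∧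
        z ⬝ᵥ ((redMat (placeForm H' w.1) * redMat (ϖ⁻¹ • ((((x).val : GL (Fin 3) (UnitaryGroup.LocalRing L v)).val.map (Pi.evalRingHom (fun w' : PlacesOver L v => w'.1.adicCompletion L) w)) - 1))) *ᵥ z) ≠ 0 ∧ ¬ IsSquare (z ⬝ᵥ ((redMat (placeForm H' w.1) * redMat (ϖ⁻¹ • ((((x).val : GL (Fin 3) (UnitaryGroup.LocalRing L v)).val.map (Pi.evalRingHom (fun w' : PlacesOver L v => w'.1.adicCompletion L) w)) - 1))) *ᵥ z))) →
        g x = c₁n))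
    -- `y_λ ∈ L⁺_v` with `ι_w y_λ = −det H′_w` (the C-Δ Levi value's Hilbert symbol `(y_λ, θ)_v`)
    (yl : v.adicCompletion ↥(maximalRealSubfield L)) (_hyl : toPlace v w yl = -(placeForm H' w.1).det)
    -- the three inputs: the type-(2) G-side rows (even ∕ odd depth) ON A NEIGHBOURHOOD OF `1` (∃V-shaped, A′e-symmetric; skeleton v0.6 :78 ∕ :151) and the mass ratio (v0.6 :223)
    (hGe : ∃ V ∈ 𝓝 (1 : ((cmDatum L 2 (Matrix.of fun i j : Fin 2 => if i.val + j.val + 1 = 2 then (1 : L) else 0)).Local v × (cmDatum L 1 (Matrix.of fun i j : Fin 1 => if i.val + j.val + 1 = 1 then (1 : L) else 0)).Local v)), ∀ γH ∈ V, IsLocalGRegular L v γH →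
      ¬ (∃ x : (w.1.adicCompletion L), ((((γH.1.val : GL (Fin 2) (UnitaryGroup.LocalRing L v)).val.map (Pi.evalRingHom (fun w' : PlacesOver L v => w'.1.adicCompletion L) w))).charpoly).IsRoot x) →
      ∀ n : ℕ, Valued.v ((((γH.1.val : GL (Fin 2) (UnitaryGroup.LocalRing L v)).val.map (Pi.evalRingHom (fun w' : PlacesOver L v => w'.1.adicCompletion L) w))).trace ^ 2 - 4 * (((γH.1.val : GL (Fin 2) (UnitaryGroup.LocalRing L v)).val.map (Pi.evalRingHom (fun w' : PlacesOver L v => w'.1.adicCompletion L) w))).det) = WithZero.exp (-((2 * (2 * n) : ℕ) : ℤ)) → 1 ≤ n →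
      ∑ᶠ cG : ConjClasses ((cmDatum L 3 H').Local v),
            ((finExplicitCollection L H' μ (finExplicitDelta_conj_left_all L H' μ) (finExplicitDelta_conj_right_all L H' μ)) v).Δ γH (Quotient.out cG) *
              classOrbitalIntegral mG g cG =
      (hilbertSymbol (v.adicCompletion ↥(maximalRealSubfield L)) yl
        (algebraMap ↥(maximalRealSubfield L) _ ((cmQuadraticGenerator L : 𝓞 ↥(maximalRealSubfield L)) : ↥(maximalRealSubfield L))) : ℂ) *
          (νG.real (cmLocalIntegralLevel L 3 H' v : Set ((cmDatum L 3 H').Local v)) : ℂ) *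
          (c₂ * (((Ideal.absNorm v.asIdeal : ℂ) + 1) * (Ideal.absNorm v.asIdeal : ℂ) ^ n / (Ideal.absNorm v.asIdeal : ℂ)) + c' 2 * (((Ideal.absNorm v.asIdeal : ℂ) + 1) * (Ideal.absNorm v.asIdeal : ℂ) ^ n / (Ideal.absNorm v.asIdeal : ℂ) ^ 2) +
            c₁s * (((Ideal.absNorm v.asIdeal : ℂ) + 1) * ((Ideal.absNorm v.asIdeal : ℂ) ^ n - 2 * (Ideal.absNorm v.asIdeal : ℂ)) / (2 * (Ideal.absNorm v.asIdeal : ℂ) ^ 3)) + c₁n * (((Ideal.absNorm v.asIdeal : ℂ) + 1) * ((Ideal.absNorm v.asIdeal : ℂ) ^ n - 2 * (Ideal.absNorm v.asIdeal : ℂ)) / (2 * (Ideal.absNorm v.asIdeal : ℂ) ^ 3)) +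
            c' 0 * (((((Ideal.absNorm v.asIdeal : ℂ) + 1) * ∑ k ∈ Finset.range n, (Ideal.absNorm v.asIdeal : ℂ) ^ k) - 1) / (Ideal.absNorm v.asIdeal : ℂ) ^ 3)))
    (hGo : ∃ V ∈ 𝓝 (1 : ((cmDatum L 2 (Matrix.of fun i j : Fin 2 => if i.val + j.val + 1 = 2 then (1 : L) else 0)).Local v × (cmDatum L 1 (Matrix.of fun i j : Fin 1 => if i.val + j.val + 1 = 1 then (1 : L) else 0)).Local v)), ∀ γH ∈ V, IsLocalGRegular L v γH →
      ¬ (∃ x : (w.1.adicCompletion L), ((((γH.1.val : GL (Fin 2) (UnitaryGroup.LocalRing L v)).val.map (Pi.evalRingHom (fun w' : PlacesOver L v => w'.1.adicCompletion L) w))).charpoly).IsRoot x) →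
      ∀ n : ℕ, Valued.v ((((γH.1.val : GL (Fin 2) (UnitaryGroup.LocalRing L v)).val.map (Pi.evalRingHom (fun w' : PlacesOver L v => w'.1.adicCompletion L) w))).trace ^ 2 - 4 * (((γH.1.val : GL (Fin 2) (UnitaryGroup.LocalRing L v)).val.map (Pi.evalRingHom (fun w' : PlacesOver L v => w'.1.adicCompletion L) w))).det) = WithZero.exp (-((2 * (2 * n + 1) : ℕ) : ℤ)) → 1 ≤ n →
      ∑ᶠ cG : ConjClasses ((cmDatum L 3 H').Local v),
            ((finExplicitCollection L H' μ (finExplicitDelta_conj_left_all L H' μ) (finExplicitDelta_conj_right_all L H' μ)) v).Δ γH (Quotient.out cG) *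
              classOrbitalIntegral mG g cG =
      (hilbertSymbol (v.adicCompletion ↥(maximalRealSubfield L)) yl
        (algebraMap ↥(maximalRealSubfield L) _ ((cmQuadraticGenerator L : 𝓞 ↥(maximalRealSubfield L)) : ↥(maximalRealSubfield L))) : ℂ) *
          (νG.real (cmLocalIntegralLevel L 3 H' v : Set ((cmDatum L 3 H').Local v)) : ℂ) *
          (c₂ * (2 * (Ideal.absNorm v.asIdeal : ℂ) ^ n) + c' 2 * (2 * (Ideal.absNorm v.asIdeal : ℂ) ^ n / (Ideal.absNorm v.asIdeal : ℂ)) + c₁s * (((Ideal.absNorm v.asIdeal : ℂ) ^ n - (Ideal.absNorm v.asIdeal : ℂ) - 1) / (Ideal.absNorm v.asIdeal : ℂ) ^ 2) + c₁n * (((Ideal.absNorm v.asIdeal : ℂ) ^ n - (Ideal.absNorm v.asIdeal : ℂ) - 1) / (Ideal.absNorm v.asIdeal : ℂ) ^ 2) +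
            c' 0 * (2 * ((Ideal.absNorm v.asIdeal : ℂ) ^ n - 1) / (((Ideal.absNorm v.asIdeal : ℂ) - 1) * (Ideal.absNorm v.asIdeal : ℂ) ^ 2))))
    (hM2 : 2 * νH.real {h : ((cmDatum L 2 (Matrix.of fun i j : Fin 2 => if i.val + j.val + 1 = 2 then (1 : L) else 0)).Local v × (cmDatum L 1 (Matrix.of fun i j : Fin 1 => if i.val + j.val + 1 = 1 then (1 : L) else 0)).Local v) | ∀ a b : Fin 2, Valued.v (ϖ ^ (b : ℕ) * (ϖ ^ (a : ℕ))⁻¹ * ((((localNonsplitEquiv (IsCMField.complexConj L) (Matrix.of fun i j : Fin 2 => if i.val + j.val + 1 = 2 then (1 : L) else 0) (IsCMField.complexConj_ne_one L) w hw) h.1 : ↥(unitaryGroupOfForm (galAdicCompletionMap (L := L) (IsCMField.complexConj L) hw) (placeForm (Matrix.of fun i j : Fin 2 => if i.val + j.val + 1 = 2 then (1 : L) else 0) w.1))) : GL (Fin 2) (w.1.adicCompletion L)) : Matrix (Fin 2) (Fin 2) (w.1.adicCompletion L)) a b) ≤ 1} = ((Ideal.absNorm v.asIdeal : ℝ) +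 1) * νH.real (((cmLocalIntegralLevel L 2 (Matrix.of fun i j : Fin 2 => if i.val + j.val + 1 = 2 then (1 : L) else 0) v).prod (cmLocalIntegralLevel L 1 (Matrix.of fun i j : Fin 1 => if i.val + j.val + 1 = 1 then (1 : L) else 0) v) : Subgroup ((cmDatum L 2 (Matrix.of fun i j : Fin 2 => if i.val + j.val + 1 = 2 then (1 : L) else 0)).Local v × (cmDatum L 1 (Matrix.of fun i j : Fin 1 => if i.val + j.val + 1 = 1 then (1 : L) else 0)).Local v)) : Set ((cmDatum L 2 (Matrix.of fun i j : Fin 2 => if i.val + j.val + 1 = 2 then (1 : L) else 0)).Local v × (cmDatum L 1 (Matrix.of fun i j : Fin 1 => if i.val + j.val + 1 = 1 then (1 : L) else 0)).Local v))) :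
    (∃ V ∈ 𝓝 (1 : ((cmDatum L 2 (Matrix.of fun i j : Fin 2 => if i.val + j.val + 1 = 2 then (1 : L) else 0)).Local v × (cmDatum L 1 (Matrix.of fun i j : Fin 1 => if i.val + j.val + 1 = 1 then (1 : L) else 0)).Local v)), ∀ γH ∈ V, IsLocalGRegular L v γH →
      ¬ (∃ x : w.1.adicCompletion L, (((((γH).1.val : GL (Fin 2) (UnitaryGroup.LocalRing L v)).val.map (Pi.evalRingHom (fun w' : PlacesOver L v => w'.1.adicCompletion L) w))).charpoly).IsRoot x) →
      ∑ᶠ cG : ConjClasses ((cmDatum L 3 H').Local v),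
            ((finExplicitCollection L H' μ (finExplicitDelta_conj_left_all L H' μ) (finExplicitDelta_conj_right_all L H' μ)) v).Δ γH (Quotient.out cG) *
              classOrbitalIntegral mG g cG =
        ∑ s, (![((hilbertSymbol (v.adicCompletion ↥(maximalRealSubfield L)) yl
        (algebraMap ↥(maximalRealSubfield L) _ ((cmQuadraticGenerator L : 𝓞 ↥(maximalRealSubfield L)) : ↥(maximalRealSubfield L))) : ℂ) *
          (νG.real (cmLocalIntegralLevel L 3 H' v : Set ((cmDatum L 3 H').Local v)) : ℂ) / (νH.real (((cmLocalIntegralLevel L 2 (Matrix.of fun i j : Fin 2 => if i.val + j.val + 1 = 2 then (1 : L) else 0) v).prod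
                (cmLocalIntegralLevel L 1 (Matrix.of fun i j : Fin 1 => if i.val + j.val + 1 = 1 then (1 : L) else 0) v) : Subgroup _) : Set _) : ℂ)) * (c₂ * (-2 / (Ideal.absNorm v.asIdeal : ℂ)) + c' 2 * (-2 / (Ideal.absNorm v.asIdeal : ℂ) ^ 2) + c₁s * (((Ideal.absNorm v.asIdeal : ℂ) ^ 2 + (Ideal.absNorm v.asIdeal : ℂ) - 1) / (Ideal.absNorm v.asIdeal : ℂ) ^ 3) + c₁n * (((Ideal.absNorm v.asIdeal : ℂ) ^ 2 + (Ideal.absNorm v.asIdeal : ℂ) - 1) / (Ideal.absNorm v.asIdeal : ℂ) ^ 3) +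
          c' 0 * (2 / (Ideal.absNorm v.asIdeal : ℂ) ^ 3)),
        (2 / ((Ideal.absNorm v.asIdeal : ℂ) + 1) * ((hilbertSymbol (v.adicCompletion ↥(maximalRealSubfield L)) yl
        (algebraMap ↥(maximalRealSubfield L) _ ((cmQuadraticGenerator L : 𝓞 ↥(maximalRealSubfield L)) : ↥(maximalRealSubfield L))) : ℂ) *
          (νG.real (cmLocalIntegralLevel L 3 H' v : Set ((cmDatum L 3 H').Local v)) : ℂ) / (νH.real (((cmLocalIntegralLevel L 2 (Matrix.of fun i j : Fin 2 => if i.val + j.val + 1 = 2 then (1 : L) else 0) v).prod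
                (cmLocalIntegralLevel L 1 (Matrix.of fun i j : Fin 1 => if i.val + j.val + 1 = 1 then (1 : L) else 0) v) : Subgroup _) : Set _) : ℂ))) * (c₂ * (((Ideal.absNorm v.asIdeal : ℂ) + 1) / (Ideal.absNorm v.asIdeal : ℂ)) + c' 2 * (((Ideal.absNorm v.asIdeal : ℂ) + 1) / (Ideal.absNorm v.asIdeal : ℂ) ^ 2) + c₁s * (-(((Ideal.absNorm v.asIdeal : ℂ) + 1) * (2 * (Ideal.absNorm v.asIdeal : ℂ) - 1)) / (2 * (Ideal.absNorm v.asIdeal : ℂ) ^ 3)) +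
          c₁n * (-(((Ideal.absNorm v.asIdeal : ℂ) + 1) * (2 * (Ideal.absNorm v.asIdeal : ℂ) - 1)) / (2 * (Ideal.absNorm v.asIdeal : ℂ) ^ 3)) + c' 0 * (-1 / (Ideal.absNorm v.asIdeal : ℂ) ^ 3))] : Fin 2 → ℂ) s * stableOrbitalIntegralRel (IsLocalStablyConjH L v) mH ((![((((cmLocalIntegralLevel L 2 (Matrix.of fun i j : Fin 2 => if i.val + j.val + 1 = 2 then (1 : L) else 0) v).prod (cmLocalIntegralLevel L 1 (Matrix.of fun i j : Fin 1 => if i.val + j.val + 1 = 1 then (1 : L) else 0) v) : Subgroup _) : Set _).indicator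
              (fun h => if (redMat (((h.1.val : GL (Fin 2) (UnitaryGroup.LocalRing L v)).val.map (Pi.evalRingHom (fun w' : PlacesOver L v => w'.1.adicCompletion L) w))) - 1) ^ 2 = 0 ∧ (redMat (((h.1.val : GL (Fin 2) (UnitaryGroup.LocalRing L v)).val.map (Pi.evalRingHom (fun w' : PlacesOver L v => w'.1.adicCompletion L) w))) - 1).rank = 0 then (1 : ℂ) else 0)),
        (Set.indicator {h : ((cmDatum L 2 (Matrix.of fun i j : Fin 2 => if i.val + j.val + 1 = 2 then (1 : L) else 0)).Local v × (cmDatum L 1 (Matrix.of fun i j : Fin 1 => if i.val + j.val + 1 = 1 then (1 : L) else 0)).Local v) | ∀ a b : Fin 2, Valued.v (ϖ ^ (b : ℕ) * (ϖ ^ (a : ℕ))⁻¹ * (((localNonsplitEquiv (IsCMField.complexConj L) (Matrix.of fun i j : Fin 2 => if i.val + j.val + 1 = 2 then (1 : L) else 0) (IsCMField.complexConj_ne_one L) w hw h.1 : ↥(unitaryGroupOfForm (galAdicCompletionMap (L := L) (IsCMField.complexConj L) hw) (placeForm (Matrix.of fun i j : Fin 2 => if i.val + j.val + 1 = 2 then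 (1 : L) else 0) w.1))) : GL (Fin 2) (w.1.adicCompletion L)) : Matrix (Fin 2) (Fin 2) (w.1.adicCompletion L)) a b) ≤ 1} (fun _ => (1 : ℂ)))] : Fin 2 → ((cmDatum L 2 (Matrix.of fun i j : Fin 2 => if i.val + j.val + 1 = 2 then (1 : L) else 0)).Local v × (cmDatum L 1 (Matrix.of fun i j : Fin 1 => if i.val + j.val + 1 = 1 then (1 : L) else 0)).Local v) → ℂ) s) γH) := by
  have hc1 : IsCMField.complexConj L ≠ 1 := IsCMField.complexConj_ne_one L
  -- `|2|_v = |2|_w = 1`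
  obtain ⟨h2v, h2v0⟩ := valued_two_eq_one_of_isUnit_two_of_ramified L v w hw he h2
  obtain ⟨h2w, h2w0⟩ := valued_two_eq_one_of_ramified L v w hw he h2v
  -- the uniformiser as a unit
  have hϖ0 : ϖ ≠ 0 := by
    intro h0; rw [h0, map_zero] at hϖ; exact WithZero.coe_ne_zero hϖ.symm
  obtain ⟨ϖu, hϖu⟩ : ∃ ϖu : (w.1.adicCompletion L)ˣ, (ϖu : (w.1.adicCompletion L)) = ϖ := ⟨Units.mk0 ϖ hϖ0, rfl⟩
  subst hϖu
  -- the `ϖ`-modular level `K₂ 1 ↔ D_ϖ GL₂(𝒪_w) D_ϖ⁻¹` (★ `exists_vertexCover_of_ramified`)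
  obtain ⟨K₂, -, -, hd1, hK₂o, hK₂c, -⟩ := exists_vertexCover_of_ramified L v w hw he h2w ϖu hϖ hσϖ
  -- `q`
  have hq : Nat.card (𝓞 ↥(maximalRealSubfield L) ⧸ v.asIdeal) = Ideal.absNorm v.asIdeal := by
    rw [Ideal.absNorm_apply, Submodule.cardQuot_apply]
  have hq2 : 2 ≤ Ideal.absNorm v.asIdeal := by
    classical
    rw [← hq]
    haveI : Finite (𝓞 ↥(maximalRealSubfield L) ⧸ v.asIdeal) := Ideal.finiteQuotientOfFreeOfNeBot v.asIdeal v.ne_bot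
    haveI : Nontrivial (𝓞 ↥(maximalRealSubfield L) ⧸ v.asIdeal) := Ideal.Quotient.nontrivial_iff.2 v.isPrime.ne_top
    exact Finite.one_lt_card
  have hq0 : (Ideal.absNorm v.asIdeal : ℂ) ≠ 0 := Nat.cast_ne_zero.2 (by omega)
  have hq1 : (Ideal.absNorm v.asIdeal : ℂ) + 1 ≠ 0 := by
    have h : ((Ideal.absNorm v.asIdeal + 1 : ℕ) : ℂ) ≠ 0 := Nat.cast_ne_zero.2 (by omega)
    push_cast at h; exact h
  -- `ν_H(K_H) ≠ 0` and the mass ratio (M2) read on `K₂ 1 × ⊤`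
  have hset : {h : ((cmDatum L 2 (Matrix.of fun i j : Fin 2 => if i.val + j.val + 1 = 2 then (1 : L) else 0)).Local v × (cmDatum L 1 (Matrix.of fun i j : Fin 1 => if i.val + j.val + 1 = 1 then (1 : L) else 0)).Local v) | ∀ a b : Fin 2, Valued.v ((ϖu : (w.1.adicCompletion L)) ^ (b : ℕ) * ((ϖu : (w.1.adicCompletion L)) ^ (a : ℕ))⁻¹ * ((((localNonsplitEquiv (IsCMField.complexConj L) (Matrix.of fun i j : Fin 2 => if i.val + j.val + 1 = 2 then (1 : L) else 0) (IsCMField.complexConj_ne_one L) w hw) h.1 : ↥(unitaryGroupOfForm (galAdicCompletionMap (L := L) (IsCMField.complexConj L) hw) (placeForm (Matrix.of fun i j : Fin 2 => if i.val + j.val + 1 = 2 then (1 : L) else 0) w.1))) : GL (Fin 2) (w.1.adicCompletion L)) : Matrix (Fin 2) (Fin 2) (w.1.adicCompletion L)) a b) ≤ 1} =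
      (((K₂ 1).prod (⊤ : Subgroup ((cmDatum L 1 (Matrix.of fun i j : Fin 1 => if i.val + j.val + 1 = 1 then (1 : L) else 0)).Local v)) : Subgroup ((cmDatum L 2 (Matrix.of fun i j : Fin 2 => if i.val + j.val + 1 = 2 then (1 : L) else 0)).Local v × (cmDatum L 1 (Matrix.of fun i j : Fin 1 => if i.val + j.val + 1 = 1 then (1 : L) else 0)).Local v)) : Set ((cmDatum L 2 (Matrix.of fun i j : Fin 2 => if i.val + j.val + 1 = 2 then (1 : L) else 0)).Local v × (cmDatum L 1 (Matrix.of fun i j : Fin 1 => if i.val + j.val + 1 = 1 then (1 : L) else 0)).Local v)) := by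
    ext h
    rw [Set.mem_setOf_eq, SetLike.mem_coe, Subgroup.mem_prod, hd1 h.1, forall_v_sharp_iff_coe_mem_map_conj L w hw ϖu]
    simp only [Subgroup.mem_top, and_true]
  have hKpos : (νH.real (((cmLocalIntegralLevel L 2 (Matrix.of fun i j : Fin 2 => if i.val + j.val + 1 = 2 then (1 : L) else 0) v).prod (cmLocalIntegralLevel L 1 (Matrix.of fun i j : Fin 1 => if i.val + j.val + 1 = 1 then (1 : L) else 0) v) : Subgroup ((cmDatum L 2 (Matrix.of fun i j : Fin 2 => if i.val + j.val + 1 = 2 then (1 : L) else 0)).Local v × (cmDatum L 1 (Matrix.of fun i j : Fin 1 => if i.val + j.val + 1 = 1 then (1 : L) else 0)).Local v)) : Set ((cmDatum L 2 (Matrix.of fun i j : Fin 2 => if i.val + j.val + 1 = 2 then (1 : L) else 0)).Local v × (cmDatum L 1 (Matrix.of fun i j : Fin 1 => if i.val + j.val + 1 = 1 then (1 : L) else 0)).Local v)) : ℂ) ≠ 0 := by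
    have hK2 := isCompact_isOpen_cmLocalIntegralLevel L 2 (Matrix.of fun i j : Fin 2 => if i.val + j.val + 1 = 2 then (1 : L) else 0) v
    have hK1 := isCompact_isOpen_cmLocalIntegralLevel L 1 (Matrix.of fun i j : Fin 1 => if i.val + j.val + 1 = 1 then (1 : L) else 0) v
    rw [Complex.ofReal_ne_zero, measureReal_def, Subgroup.coe_prod]
    exact (ENNReal.toReal_pos ((hK2.2.prod hK1.2).measure_pos νH ⟨(1, 1), Subgroup.one_mem _, Subgroup.one_mem _⟩).ne'
      (hK2.1.prod hK1.1).measure_lt_top.ne).ne'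
  have hmass : (νH.real (((K₂ 1).prod (⊤ : Subgroup ((cmDatum L 1 (Matrix.of fun i j : Fin 1 => if i.val + j.val + 1 = 1 then (1 : L) else 0)).Local v)) : Subgroup ((cmDatum L 2 (Matrix.of fun i j : Fin 2 => if i.val + j.val + 1 = 2 then (1 : L) else 0)).Local v × (cmDatum L 1 (Matrix.of fun i j : Fin 1 => if i.val + j.val + 1 = 1 then (1 : L) else 0)).Local v)) : Set ((cmDatum L 2 (Matrix.of fun i j : Fin 2 => if i.val + j.val + 1 = 2 then (1 : L) else 0)).Local v × (cmDatum L 1 (Matrix.of fun i j : Fin 1 => if i.val + j.val + 1 = 1 then (1 : L) else 0)).Local v)) : ℂ) =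
      ((Ideal.absNorm v.asIdeal : ℂ) + 1) / 2 * (νH.real (((cmLocalIntegralLevel L 2 (Matrix.of fun i j : Fin 2 => if i.val + j.val + 1 = 2 then (1 : L) else 0) v).prod (cmLocalIntegralLevel L 1 (Matrix.of fun i j : Fin 1 => if i.val + j.val + 1 = 1 then (1 : L) else 0) v) : Subgroup ((cmDatum L 2 (Matrix.of fun i j : Fin 2 => if i.val + j.val + 1 = 2 then (1 : L) else 0)).Local v × (cmDatum L 1 (Matrix.of fun i j : Fin 1 => if i.val + j.val + 1 = 1 then (1 : L) else 0)).Local v)) : Set ((cmDatum L 2 (Matrix.of fun i j : Fin 2 => if i.val + j.val + 1 = 2 then (1 : L) else 0)).Local v × (cmDatum L 1 (Matrix.of fun i j : Fin 1 => if i.val + j.val + 1 = 1 then (1 : L) else 0)).Local v)) : ℂ) := by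
    rw [hset] at hM2
    have h := congrArg (fun x : ℝ => (x : ℂ)) hM2
    simp only [Complex.ofReal_mul, Complex.ofReal_add, Complex.ofReal_natCast, Complex.ofReal_one, Complex.ofReal_ofNat] at h
    linear_combination h / 2
  -- the neighbourhood: `V_e ∩ V_o ∩` the 2-deep tube (★ `setOf_entrywise_deep_mem_nhds_one` at `c := ϖ²`)
  obtain ⟨Ve, hVe, hGe⟩ := hGe
  obtain ⟨Vo, hVo, hGo⟩ := hGo
  have hϖ2 : ((ϖu : (w.1.adicCompletion L)) ^ 2) ≠ 0 := pow_ne_zero _ (Units.ne_zero ϖu)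
  refine ⟨Ve ∩ Vo ∩ _, Filter.inter_mem (Filter.inter_mem hVe hVo) (setOf_entrywise_deep_mem_nhds_one L v w hϖ2), ?_⟩
  intro γH hγV hreg hirr
  obtain ⟨⟨hγe, hγo⟩, hdeep2, -⟩ := hγV
  -- 2-deep ⇒ 1-deep (the H-side ★ FILE C is keyed on the 1-deep token)
  have hϖ1 : Valued.v (ϖu : (w.1.adicCompletion L)) ≤ 1 := by rw [hϖ, ← WithZero.exp_zero, WithZero.exp_le_exp]; norm_num
  have hdeep : ∀ i j : Fin 2, Valued.v (((((γH.1.val : GL (Fin 2) (UnitaryGroup.LocalRing L v)).val.map (Pi.evalRingHom (fun w' : PlacesOver L v => w'.1.adicCompletion L) w))) - 1) i j) ≤ Valued.v (ϖu : (w.1.adicCompletion L)) :=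
    fun i j => (hdeep2 i j).trans (by rw [map_pow, sq]; exact mul_le_of_le_one_left' hϖ1)
  -- integrality of `tr`, `det`, and `disc ≠ 0` (no root, `2 ≠ 0`), hence the depth token `exp(−2N)`
  have hone : Valued.v ((1 : (w.1.adicCompletion L)) - 1) ≤ WithZero.exp (-1 : ℤ) := by rw [sub_self, map_zero]; exact zero_le
  obtain ⟨-, -, htr2, hdet1⟩ := valuation_quadratic_bounds_of_entrywise_deep (((γH.1.val : GL (Fin 2) (UnitaryGroup.LocalRing L v)).val.map (Pi.evalRingHom (fun w' : PlacesOver L v => w'.1.adicCompletion L) w))) 1 (fun i j => (hdeep i j).trans hϖ.le) hone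
  have he1 : WithZero.exp (-1 : ℤ) ≤ 1 := by rw [← WithZero.exp_zero, WithZero.exp_le_exp]; norm_num
  have htr : Valued.v (((γH.1.val : GL (Fin 2) (UnitaryGroup.LocalRing L v)).val.map (Pi.evalRingHom (fun w' : PlacesOver L v => w'.1.adicCompletion L) w))).trace ≤ 1 := by
    have e : (((γH.1.val : GL (Fin 2) (UnitaryGroup.LocalRing L v)).val.map (Pi.evalRingHom (fun w' : PlacesOver L v => w'.1.adicCompletion L) w))).trace = ((((γH.1.val : GL (Fin 2) (UnitaryGroup.LocalRing L v)).val.map (Pi.evalRingHom (fun w' : PlacesOver L v => w'.1.adicCompletion L) w))).trace - 2) + 2 := by ring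
    rw [e]
    exact (Valuation.map_add _ _ _).trans (max_le (htr2.trans he1) h2w.le)
  have hdet : Valued.v (((γH.1.val : GL (Fin 2) (UnitaryGroup.LocalRing L v)).val.map (Pi.evalRingHom (fun w' : PlacesOver L v => w'.1.adicCompletion L) w))).det ≤ 1 := by
    have e : (((γH.1.val : GL (Fin 2) (UnitaryGroup.LocalRing L v)).val.map (Pi.evalRingHom (fun w' : PlacesOver L v => w'.1.adicCompletion L) w))).det = ((((γH.1.val : GL (Fin 2) (UnitaryGroup.LocalRing L v)).val.map (Pi.evalRingHom (fun w' : PlacesOver L v => w'.1.adicCompletion L) w))).det - 1) + 1 := by ring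
    rw [e]
    exact (Valuation.map_add _ _ _).trans (max_le (hdet1.trans he1) (by rw [map_one]))
  have hD0 : (((γH.1.val : GL (Fin 2) (UnitaryGroup.LocalRing L v)).val.map (Pi.evalRingHom (fun w' : PlacesOver L v => w'.1.adicCompletion L) w))).trace ^ 2 - 4 * (((γH.1.val : GL (Fin 2) (UnitaryGroup.LocalRing L v)).val.map (Pi.evalRingHom (fun w' : PlacesOver L v => w'.1.adicCompletion L) w))).det ≠ 0 := by
    intro h0
    refine hirr ⟨(((γH.1.val : GL (Fin 2) (UnitaryGroup.LocalRing L v)).val.map (Pi.evalRingHom (fun w' : PlacesOver L v => w'.1.adicCompletion L) w))).trace / 2, ?_⟩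
    rw [Matrix.charpoly_fin_two, Polynomial.IsRoot.def]
    simp only [Polynomial.eval_add, Polynomial.eval_sub, Polynomial.eval_mul, Polynomial.eval_pow, Polynomial.eval_C, Polynomial.eval_X]
    field_simp
    linear_combination (-1 : (w.1.adicCompletion L)) * h0
  obtain ⟨N, hN⟩ := exists_valued_disc_eq_exp_neg_even_of_ne_zero_ramified L v w hw he htr hdet hD0
  -- `2 ≤ N` on the 2-deep tube: `|tr² − 4det| ≤ |ϖ²|² = exp(−4)`
  have hN2 : 2 ≤ N := by
    have h4 := valued_disc_le_sq_of_entrywise_le (((γH.1.val : GL (Fin 2) (UnitaryGroup.LocalRing L v)).val.map (Pi.evalRingHom (fun w' : PlacesOver L v => w'.1.adicCompletion L) w))) hdeep2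
    rw [hN, map_pow, hϖ, ← pow_mul, ← WithZero.exp_nsmul, WithZero.exp_le_exp, nsmul_eq_mul] at h4
    push_cast at h4
    omega
  -- the row: `Σ_s a(c)_s · Φ^st(γ_H, ψ^ram_s)` with `s = 0, 1`
  rw [Fin.sum_univ_two]
  simp only [Matrix.cons_val_zero, Matrix.cons_val_one]
  obtain ⟨n, rfl | rfl⟩ := Nat.even_or_odd' N
  · -- EVEN depth `2n`: vertex ball
    rw [hGe γH hγe hreg hirr n hN (by omega)]
    obtain ⟨hsharp, hzero⟩ := stableOrbitalIntegralRel_typeTwo_HSide_of_even_depth_ramified L v w hw he h2 ϖu hϖ hσϖ (K₂ 1) hd1 (hK₂o 1) (hK₂c 1) νH hmH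
      hreg hirr hdeep (fun _ => inferInstance) hN
    rw [hq] at hsharp hzero
    rw [hzero, hsharp, hmass,
      span_typeTwoUnr_of_strata_values (q := Ideal.absNorm v.asIdeal) (by omega) n _ c₂ (c' 2) c₁s c₁n (c' 0)]
    field_simp
  · -- ODD depth `2n + 1`: edge ball
    rw [hGo γH hγo hreg hirr n hN (by omega)]
    obtain ⟨hsharp, hzero⟩ := stableOrbitalIntegralRel_typeTwo_HSide_of_odd_depth_ramified L v w hw he h2 ϖu hϖ hσϖ (K₂ 1) hd1 (hK₂o 1) (hK₂c 1) νH hmH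
      hreg hirr hdeep (fun _ => inferInstance) hN
    rw [hq] at hsharp hzero
    rw [hzero, hsharp, hmass,
      span_typeTwoRam_of_strata_values (q := Ideal.absNorm v.asIdeal) hq2 n _ c₂ (c' 2) c₁s c₁n (c' 0)]
    field_simp

end Literature.NumberTheory.Rogawski1990

end
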